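import Summits.BirchSwinnertonDyer.BirchSwinnertonDyer.Theorems.KatoDescentTamePotSupersingularTameUpperNonsurjSharpNodes
import Summits.BirchSwinnertonDyer.BirchSwinnertonDyer.Theorems.KatoDescentTamePotSupersingularTameFineSelmerCongruenceRoad
import HarnessLib

/-!
# Route `KatoDescentTamePotSupersingular` (rung K8, sub-rung B4 (t′), cell `bsd-potss`): the BODY of the U₀-ns node
# `TameUpperNonsurjTower` (item 19202) with the ♯ / Manin-dirty rows dischargeable PER ROW by ANY of the cell's three
# currencies — (i) the Kolyvagin–Jetchev sharp index bound (this seat g6, p471595/p471788), (ii) Coates–Sujatha's (A)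
# at the row (crux 19413), (iii) ONE congruent anchor carrying (A) or finite `Sel_{p^∞}[p]` (g4 / k9-c4, Lim–Sujatha) —
# route-free `--supports` file (seat `bsd-potss-k8t-c4` g6); nothing booked, no item closed, BSD not proved

WHY. The planner's ♯ re-cut of crux 19413 (TARGET R100) needs ONE term for `h₄a` in `closes`. After g3 (road (ii)), g4
(road (iii)) and g6 (road (i)) the tree has three 19202-body theorems with three different ♯ binders. This file states
the 19202 BODY once, with a single per-row hypothesis `hrow` that is the DISJUNCTION of the three currencies, so that
a re-cut item «per ♯ row: (H♯) with a Manin-clean datum ∨ (A) ∨ a congruent anchor» has its glue PROVABLE NOW: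
`upperNonsurjTower_of_lower_of_rankOne_of_sharpCurrencies`. Rows: CM → Burungale–Flach; `ρ̄_{E,p}` onto → void;
Manin-clean ♭ (`p ∤ c(D)·∏c_ℓ`) → g3's Heegner road over Matar–Nekovář's printed bound (no currency needed);
remaining rows → the currency supplied: (i) ⇒ the sharp Heegner road (`TameUpperHeegnerSharpRoad.…`), (ii) ⇒ the
fine-Selmer port of Kato 14.5 (3) (via g6's node with (i) vacuous), (iii) ⇒ (ii) by Lim–Sujatha 2018 Prop. 3.2
(`WildFineSelmerCongruenceFact.conjA_of_modPCongruent`, k9-c4) and the ordinary-anchor lemma. HONEST STATUS of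
the currencies: (i) = Jetchev 2008 Thm. 1.4 / Cor. 1.5 in the irreducible reading (his Rem. 6.2 + Matar–Nekovář
2019 §0.11; D-audit items A1/A2 of FINDING-19413-sharp-heegner-k8t-c4-g6.md; NOT a published theorem), (ii) =
Coates–Sujatha Conj. A at the row (open), (iii) = a per-row certificate (census reach measured by g4 / conjA-anchor).
Conditional throughout; nothing asserted; NO item is closed.

References: [Jetchev2008] Thm. 1.4, Cor. 1.5, Rem. 6.2; [MatarNekovar2019] Thm. 0.3, §0.11; [LimSujatha2018] Prop. 3.2;
[Kato2004Asterisque] Thm. 14.5 (3), Prop. 14.16 (2); [CoatesSujatha2005] Conj. A; [BurungaleFlach2024] Cor. 2;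
[BumpFriedbergHoffstein1990]; [GrossZagier1986] I.6.3; [Miller2011LMS] Def. 1.1.
-/

set_option autoImplicit false
-- the Theorems directory repeats the summit name (sibling precedent `KatoDescentPotSupersingularAssembly.lean`)
set_option linter.dupNamespace false

noncomputable section

open scoped Classical NumberField

namespace Summit.BirchSwinnertonDyer.BirchSwinnertonDyer.Theorems.TameUpperHeegnerSharpRoad

open WeierstrassCurve IsDedekindDomain IsDedekindDomain.HeightOneSpectrum NumberField
  Rat.HeightOneSpectrum Literature.NumberTheory.EllipticCurves
  Literature.NumberTheory.EllipticCurves.ModularForms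
  Literature.NumberTheory.DiophantineGeometry
  Literature.NumberTheory.EllipticCurves.Rank1Residual
  Literature.NumberTheory.EllipticCurves.Rank1Residual.Typed
  Literature.NumberTheory.Automorphic Literature.NumberTheory.EllipticCurves.KrizLi2019
  Literature.NumberTheory.QuadraticFields
  Summit.BirchSwinnertonDyer.Rank1Residual
  Summit.BirchSwinnertonDyer.Rank1Residual.Additive
  Summit.BirchSwinnertonDyer.Rank1Residual.O6
  Summit.BirchSwinnertonDyer.BirchSwinnertonDyer.Theorems

/-! ### §1 Private re-homings (g0/g3): the void onto rows and the fine-Selmer port -/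

/-- An odd prime other than `3` is at least `5`. [folklore] -/
private theorem five_le_of_prime_of_ne_two_of_ne_three {p : ℕ} (hp : p.Prime) (h2 : p ≠ 2)
    (h3 : p ≠ 3) : 5 ≤ p := by
  rcases Nat.lt_or_ge p 5 with h | h
  · have h2le := hp.two_le
    interval_cases p
    · exact absurd rfl h2
    · exact absurd rfl h3
    · exact absurd hp (by decide)
  · exact h

/-- **The upper half on an irreducible rank-`0` (t′) row from the finite generation of `Y(E/ℚ^cyc)` over `ℤ_p`**
(private re-homing of g0's `Theorems.missingUpperBoundAt_tame_of_irreducible_of_fineSelmerDual_fg`, whose module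
imports the route file): Kato 14.5 (3) in the fine-Selmer reading bounds `ord_p #Ш + v_p(∏c_ℓ)` by `ord_p(L/Ω)`,
`#Ш_an = (L/Ω)·#tors²/∏c_ℓ`, and the torsion term vanishes by irreducibility.
[cite: Kato2004Asterisque, Thm. 14.5 (3) (p. 236), Thm. 12.5 (3) (p. 222), 14.14 (p. 243), Prop. 14.16 (2) (p. 244)]
[cite: Lim2017FineSelmer, §3] [cite: Miller2011LMS, Def. 1.1] -/
private theorem missingUpperBoundAt_tame_of_irreducible_of_fineSelmerDual_fg
    (hKatoA :
      Kato2004.rankZero_padicValNat_sha_add_padicValNat_tamagawa_le_of_additive_potGood_of_irreducible_of_fineSelmerDual_fg)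
    (hGZK : rank_eq_analyticRank_of_analyticRank_le_one) (hmod : hasEntireLFunction_rat)
    (W : WeierstrassCurve ℚ) [W.IsElliptic] [W.IsGloballyMinimal] (p : ℕ) [Fact p.Prime]
    (hr : W.analyticRank = 0) (hp2 : p ≠ 2) (hadd : Addv W p) (hT : SubTprime W p)
    (hirr : W.HasIrreducibleModPGaloisRep p)
    (hA : ∀ (κ : ZpExtension ℚ p), κ.IsCyclotomic →
      ∃ (γ : Field.absoluteGaloisGroup ℚ) (D : W.FineSelmerDualData κ γ),
        Module.Finite ℤ_[p] (RestrictScalars ℤ_[p] (IwasawaAlgebra p) D.X)) :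
    MissingUpperBoundAt W p := by
  have hO5 : ClassO5 W p := ⟨hp2, hadd, Or.inr hT⟩
  have hL : W.entireLFunction 1 ≠ 0 := (W.analyticRank_eq_zero_iff_holds (hmod W)).mp hr
  obtain ⟨hmw, hfin⟩ := hGZK W (by rw [hr]; exact zero_le_one)
  haveI : Finite W.sha := hfin
  have hmw0 : W.mordellWeilRank = 0 := by rw [hmw, hr]
  obtain ⟨q₀, hq₀, hle⟩ := hKatoA W p hp2 hadd.1 hadd.2 hO5.padicValRat_j_nonneg hirr hA hL hfin
  have hΩ : (W.realPeriodRat : ℂ) ≠ 0 := by exact_mod_cast W.realPeriodRat_pos_holds.ne'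
  have hc0 : 0 < W.tamagawaProduct := W.tamagawaProduct_pos_holds
  have ht0 : 0 < W.torsionOrder := W.torsionOrder_pos_holds
  have hq₀0 : q₀ ≠ 0 := by
    rintro rfl
    rw [Rat.cast_zero, div_eq_zero_iff] at hq₀
    exact hq₀.elim hL hΩ
  refine ⟨q₀ * (W.torsionOrder : ℚ) ^ 2 / (W.tamagawaProduct : ℚ), ?_, ?_⟩
  · have hLq : W.entireLFunction 1 = (q₀ : ℂ) * (W.realPeriodRat : ℂ) := by
      rw [← hq₀, div_mul_cancel₀ _ hΩ]
    rw [shaAn_def, W.leadingLCoeff_eq_of_analyticRank_eq_zero hr,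
      W.regulator_eq_one_of_rank_zero hmw0, hLq]
    push_cast
    field_simp
  · have ht : (W.torsionOrder : ℚ) ≠ 0 := by exact_mod_cast ht0.ne'
    have hcq : (W.tamagawaProduct : ℚ) ≠ 0 := by exact_mod_cast hc0.ne'
    have hsha : padicValNat p (Nat.card (AddCommGroup.primaryComponent W.sha p)) =
        padicValNat p W.shaOrder := by
      unfold WeierstrassCurve.shaOrder
      exact padicValNat_card_addPrimaryComponent p
    have htors : padicValNat p W.torsionOrder = 0 := padicValNat_torsionOrder_eq_zero_of_irreducible W p hirr
    have hv : padicValRat p (q₀ * (W.torsionOrder : ℚ) ^ 2 / (W.tamagawaProduct : ℚ)) =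
        padicValRat p q₀ + 2 * (padicValNat p W.torsionOrder : ℤ) -
          (padicValNat p W.tamagawaProduct : ℤ) := by
      rw [padicValRat.div (mul_ne_zero hq₀0 (pow_ne_zero 2 ht)) hcq,
        padicValRat.mul hq₀0 (pow_ne_zero 2 ht), pow_two, padicValRat.mul ht ht,
        padicValRat.of_nat, padicValRat.of_nat]
      ring
    rw [hv, ← hsha, htors, Nat.cast_zero, mul_zero, add_zero]
    linarith

/-! ### §2 The U₀-ns BODY with the per-row currency disjunction -/

/-- **The BODY of the U₀-ns node `TameUpperNonsurjTower` (item 19202) with ONE PER-ROW CURRENCY DISJUNCTION on the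
non-CM rows with `ρ̄_{E,p}` not onto that are ♯ (`p ∣ ∏c_ℓ`) or Manin-dirty (no datum of level `N_E` with `p ∤ c`).**
Inputs: the `∀ N W K` schemata of Gross–Zagier (`hGZ`), Kolyvagin (`hKo`), Matar–Nekovář's irreducible Ш-index
bound (`hMN`); newforms (`hnf`); Bump–Friedberg–Hoffstein (`hBFH`); the bodies of `KatoTamagawaExactInputs` (19191,
`hK`), `PublishedInputsFineSelmerCM` (19387, `hF`), L₀ `TameLowerHalfRankZero` (19981, `h₂`), the residual
`TameRankOne` (19984, `hR`); Lim–Sujatha 2018 Prop. 3.2 (`hLS`); and `hrow`: on each such row EITHER (i) a datum `D`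
of level `N_E` with `p ∤ c(D)` together with the Kolyvagin–Jetchev sharp index bound at the Heegner fields of `E`
(`ord_p #Ш(E/K) + 2·ord_p ∏c_ℓ(E) ≤ 2·ord_p [E(K):ℤy_K]`, `y_K` the Heegner point of `D`, non-torsion, `d_K < −4`),
OR (ii) Coates–Sujatha's (A) at `(E,p)` (`Y(E/ℚ^cyc)` finitely generated over `ℤ_p` for every cyclotomic datum),
OR (iii) a curve `W′/ℚ` with `W′[p] ≃ W[p]` carrying (A) at `(W′,p)` or finite `Sel_{p^∞}(W′/ℚ^cyc)[p]`.
Proof, row by row: CM → Burungale–Flach; `ρ̄` onto → void; Manin-clean ♭ → g3's road; otherwise the supplied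
currency: (i) → the sharp Heegner road; (ii) → the fine-Selmer port; (iii) → (ii) by Lim–Sujatha (k9-c4's
`conjA_of_modPCongruent` / `conjA_rat_of_finite_selmerInfty_pTorsion`) → the port. Conditional; NO item is closed.
[cite: Jetchev2008, Thm. 1.4, Cor. 1.5, Rem. 6.2 (pp. 3, 15)] [cite: LimSujatha2018, §3 Prop. 3.2]
[cite: MatarNekovar2019, Thm. 0.3 (p. 456), §0.11 (p. 457)] [cite: CoatesSujatha2005, Conjecture A]
[cite: Kato2004Asterisque, Thm. 14.5 (3) (p. 236), Prop. 14.16 (2) (p. 244)] [cite: BurungaleFlach2024, Thm. 1.1 and Cor. 2 (p. 4)] -/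
theorem upperNonsurjTower_of_lower_of_rankOne_of_sharpCurrencies
    (hGZ : ∀ (N : ℕ) [NeZero N] (W : WeierstrassCurve ℚ) (K : Type) [Field K] [NumberField K],
      gross_zagier N W K)
    (hKo : ∀ (N : ℕ) [NeZero N] (W : WeierstrassCurve ℚ) (K : Type) [Field K] [NumberField K],
      kolyvagin N W K)
    (hMN : ∀ (N : ℕ) [NeZero N] (W : WeierstrassCurve ℚ) (K : Type) [Field K] [NumberField K],
      MatarNekovar2019.thm03_padicValNat_card_sha_le_of_irreducible N W K)
    (hnf : exists_isNewformOf) (hBFH : bumpFriedbergHoffstein_exists_heegnerField_split_twist_simpleZero)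
    (hK : Kato2004.rankZero_padicValNat_sha_add_padicValNat_tamagawa_le_of_additive_potGood_of_imageContainsSL2 ∧
      rank_eq_analyticRank_of_analyticRank_le_one ∧ WeierstrassCurve.hasEntireLFunction_rat)
    (hF : Kato2004.rankZero_padicValNat_sha_add_padicValNat_tamagawa_le_of_additive_potGood_of_irreducible_of_fineSelmerDual_fg ∧
      bsdTriple_of_hasCM_of_L_one_ne_zero)
    (h₂ : ∀ (W : WeierstrassCurve ℚ) [W.IsElliptic] [W.IsGloballyMinimal] (p : ℕ) [Fact p.Prime],
      W.analyticRank = 0 → p ≠ 2 → Addv W p → SubTprime W p → MissingLowerBoundAt W p)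
    (hR : ∀ (W : WeierstrassCurve ℚ) [W.IsElliptic] [W.IsGloballyMinimal] (p : ℕ) [Fact p.Prime],
      W.analyticRank = 1 → p ≠ 2 → Addv W p → SubTprime W p → MissingPPartAt W p)
    (hLS : LimSujatha2018.prop32_fineSelmerDual_moduleFinite_iff_of_torsionIso)
    (hrow : ∀ (W : WeierstrassCurve ℚ) [W.IsElliptic] [W.IsGloballyMinimal] (p : ℕ) [Fact p.Prime],
      W.analyticRank = 0 → p ≠ 2 → Addv W p → SubTprime W p → ¬ W.HasCM →
      W.HasIrreducibleModPGaloisRep p → ¬ W.HasSurjectiveModNGaloisRep p →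
      (p ∣ W.tamagawaProduct ∨ ∀ [NeZero (W.conductorNorm ℤ)]
        (D : ModularParametrizationData W (W.conductorNorm ℤ)), (p : ℤ) ∣ D.c) →
      (∀ [NeZero (W.conductorNorm ℤ)], ∃ D : ModularParametrizationData W (W.conductorNorm ℤ),
          ¬ (p : ℤ) ∣ D.c ∧
          ∀ (K : Type) [Field K] [NumberField K], IsImaginaryQuadratic K →
            SatisfiesHeegnerHypothesis (W.conductorNorm ℤ) K → NumberField.discr K < -4 →
            ∀ (H : HeegnerDatum (W.conductorNorm ℤ) (NumberField.discr K)) (ι : K →+* ℂ)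
              (P : (W.baseChange K).toAffine.Point),
              WeierstrassCurve.Affine.Point.map ι.toRatAlgHom P = heegnerPointComplex D H →
              ¬ IsOfFinAddOrder P →
              padicValNat p (Nat.card (W.baseChange K).sha) + 2 * padicValNat p W.tamagawaProduct ≤
                2 * padicValNat p (AddSubgroup.zmultiples P).index) ∨
      (∀ (κ : ZpExtension ℚ p), κ.IsCyclotomic →
          ∃ (γ : Field.absoluteGaloisGroup ℚ) (Df : W.FineSelmerDualData κ γ),
            Module.Finite ℤ_[p] (RestrictScalars ℤ_[p] (IwasawaAlgebra p) Df.X)) ∨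
      (∃ (W' : WeierstrassCurve ℚ) (_ : W'.IsElliptic), ModPCongruent W' W p ∧
        ((∀ (κ : ZpExtension ℚ p), κ.IsCyclotomic →
            ∃ (γ : Field.absoluteGaloisGroup ℚ) (D : W'.FineSelmerDualData κ γ),
              Module.Finite ℤ_[p] (RestrictScalars ℤ_[p] (IwasawaAlgebra p) D.X)) ∨
          ∀ (κ : ZpExtension ℚ p), κ.IsCyclotomic → Set.Finite {s : W'.selmerInfty κ | p • s = 0}))) :
    ∀ (W : WeierstrassCurve ℚ) [W.IsElliptic] [W.IsGloballyMinimal] (p : ℕ) [Fact p.Prime],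
      W.analyticRank = 0 → p ≠ 2 → Addv W p → SubTprime W p → W.HasIrreducibleModPGaloisRep p →
      ¬ (∀ n : ℕ, W.HasSurjectiveModNGaloisRep (p ^ n : ℕ)) → MissingUpperBoundAt W p := by
  intro W _ _ p _ hr hp2 hadd hT hI hns
  haveI : NeZero (W.conductorNorm ℤ) := ⟨(conductorNorm_pos_holds W).ne'⟩
  -- CM rows: Burungale–Flach
  by_cases hcm : W.HasCM
  · haveI : Finite W.sha := (hK.2.1 W (by rw [hr]; exact zero_le_one)).2
    exact (lower_and_upper_of_missingPPartAt W p (missingPPartAt_of_bsdp W p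
      (Summit.BirchSwinnertonDyer.Rank1Residual.bsdp_cm_rankZero hF.2 hK.2.2 hcm hr))).2
  -- `ρ̄_{E,p}` onto is void on these rows (the tower would be onto)
  by_cases hsp : W.HasSurjectiveModNGaloisRep p
  · by_cases h3 : p = 3
    · subst h3
      exact absurd (ClassX4.towerSurj_three_of_surj_of_subTprime ⟨by decide, hadd, hI⟩ hT hsp) hns
    · exact absurd (serre_hasSurjectiveModNGaloisRep_pow_holds W p
        (five_le_of_prime_of_ne_two_of_ne_three Fact.out hp2 h3) hsp) hns
  -- Manin-clean ♭ rows: the Heegner road over Matar–Nekovář's printed bound (no currency needed)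
  by_cases hclean : ¬ p ∣ W.tamagawaProduct ∧
      ∃ D : ModularParametrizationData W (W.conductorNorm ℤ), ¬ (p : ℤ) ∣ D.c
  · obtain ⟨htam, D, hc⟩ := hclean
    exact TameUpperHeegnerRoad.missingUpperBoundAt_tameIrr_rankZero_of_lower_of_rankOne hGZ hKo hMN hK.2.1 hK.2.2
      hnf hBFH h₂ hR W p hr hp2 hadd hT hI D hc htam
  -- the other rows: ♯ or Manin-dirty — take the currency supplied for this row
  have hsharp : p ∣ W.tamagawaProduct ∨ ∀ [NeZero (W.conductorNorm ℤ)]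
      (D : ModularParametrizationData W (W.conductorNorm ℤ)), (p : ℤ) ∣ D.c := by
    by_cases htam : p ∣ W.tamagawaProduct
    · exact Or.inl htam
    · refine Or.inr fun D ↦ ?_
      by_contra hcD
      exact hclean ⟨htam, D, hcD⟩
  rcases hrow W p hr hp2 hadd hT hcm hI hsp hsharp with hJD | hA | ⟨W', hW', hcong, hcur⟩
  · -- currency (i): a Manin-clean datum + the sharp index bound ⇒ the sharp Heegner road
    obtain ⟨D, hc, hJ⟩ := hJD
    exact missingUpperBoundAt_tameIrr_rankZero_of_lower_of_rankOne_of_sharpIndexBound hGZ hKo hK.2.1 hK.2.2 hnf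
      hBFH h₂ hR W p hr hp2 hadd hT hI D hc hJ
  · -- currency (ii): (A) at the row ⇒ the fine-Selmer port
    exact missingUpperBoundAt_tame_of_irreducible_of_fineSelmerDual_fg hF.1 hK.2.1 hK.2.2 W p hr hp2 hadd hT hI hA
  · -- currency (iii): a congruent anchor ⇒ (A) at the row by Lim–Sujatha ⇒ the fine-Selmer port
    haveI := hW'
    have hA : ∀ (κ : ZpExtension ℚ p), κ.IsCyclotomic →
        ∃ (γ : Field.absoluteGaloisGroup ℚ) (Df : W.FineSelmerDualData κ γ),
          Module.Finite ℤ_[p] (RestrictScalars ℤ_[p] (IwasawaAlgebra p) Df.X) := by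
      rcases hcur with hA' | hfin'
      · exact WildFineSelmerCongruenceFact.conjA_of_modPCongruent hLS hp2 hcong hA'
      · exact WildFineSelmerCongruenceFact.conjA_of_modPCongruent hLS hp2 hcong
          (WildFineSelmerOrdinaryAnchor.conjA_rat_of_finite_selmerInfty_pTorsion W' hfin')
    exact missingUpperBoundAt_tame_of_irreducible_of_fineSelmerDual_fg hF.1 hK.2.1 hK.2.2 W p hr hp2 hadd hT hI hA

end Summit.BirchSwinnertonDyer.BirchSwinnertonDyer.Theorems.TameUpperHeegnerSharpRoad

end
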